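import Summits.BirchSwinnertonDyer.Rank1Residual.Partition.MainConjecturesEisensteinBDP
import Summits.BirchSwinnertonDyer.Rank1Residual.Partition.MainConjecturesEisensteinTwistIdentity
import Summits.BirchSwinnertonDyer.Rank1Residual.X11b.QuadraticTorsionOfRam
import Literature.NumberTheory.EllipticCurves.Rank1Residual.ClassX1KellerYinMainConjecture
import Literature.NumberTheory.EllipticCurves.Rank1Residual.ClassX1KellerYinTypeA
import Literature.NumberTheory.Automorphic.ReciprocityGLnDescentProofs
import Literature.NumberTheory.Automorphic.QuadraticCharacterTwist
import Literature.NumberTheory.EllipticCurves.CastellaGrossiLeeSkinner2022.AnticyclotomicControlTorsionFree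
import Literature.NumberTheory.EllipticCurves.KellerYin2024.AnomalousAnticyclotomicMainConjecture
import Literature.NumberTheory.EllipticCurves.Wuthrich2014.ShaBoundProofs
import Literature.NumberTheory.EllipticCurves.Rank1Residual.ClassX1Isogeny
import HarnessLib

/-!
# Keller–Yin's GOOD LATTICE at an anomalous Eisenstein prime: no `K`-rational `p`-torsion (Clifford),
# and display (5.5) of [CGLS] for it from KY's IMC2 at `𝟙` ∘ BDP + the control theorem as proved
# (cell `bsd-eis`, seat `bsd-eis-ky`, THEOREM A of `HOME/bsd-eis-ky-MEMO-1.md` §2 in the kernel — file 1 of 2)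

HONEST FRAMING (cell `bsd-eis`, home `run/shared/lean/pub/bsd-eis/`; FULL-BSD rank-≤1 programme
D-0033, row A1 = X1a: good ANOMALOUS Eisenstein prime `p > 2`, parity type A, `ord_{s=1}L(E,s) = 1`,
7 892 open census cells). THEOREMS ONLY (no definition, no named fact, no `sorry`); nothing booked,
no label moved. Every unproved statement enters as an EXPLICIT named binder: the ONE preprint input is
`KellerYin2024.thm308_imc2_bdpValue_goodLattice_OPEN` (Keller–Yin arXiv:2402.12781v2 Thm. 3.0.8
(IMC2) for the good lattice, read at the trivial character and fused with the published BDP formula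
[CGLS] Thm. 5.1.3; `_OPEN`, `[claim: KellerYin2024, status: under-review]`; the cell's line-by-line
verification of exactly this statement, memo §2 L5–L9/L11 + §3, was scored PASS by the cell's
referee, `HOME/REF-VERDICT-ky-MEMO-1.md`); the control link is the PUBLISHED-AS-PROVED
`CastellaGrossiLeeSkinner2022.thm511_anticyclotomicControl_of_torsionFree` ([CGLS] Thm. 5.1.1 under
`E(K)[p] = 0`, its proof sentence L2426–L2429 = [JSW] Thm. 3.3.1 + (3.5.d); memo §4 U1–U9).

## The good lattice (KY §0.2, Prop. 1.3.1, §1.4 eq. (char to f))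

Keller–Yin run their anticyclotomic argument on ONE member `E'` of the isogeny class: `E'[p]` is the
NON-SPLIT extension `0 → 𝔽_p(φ̃) → E'[p] → 𝔽_p(ψ̃) → 0` with `φ̃|_{G_p} = ω` — in the cell's predicates
(`Rank1Residual/Predicates.lean`), since at a good ordinary `p` exactly one of the two characters is
ramified at `p`: **no rational `p`-line of `E'` is unramified at `p`**,
`hGL : ∀ Φ, IsRationalLine W p Φ → ¬ LineUnramifiedAt W p Φ` (e.g. `11a2`, not `11a1` or `11a3`, at
`5`). This file proves what the memo's link L2 needs from that normalisation and then the identity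
over `K`:

* §1 `torsion_baseChange_eq_zero_of_noUnramifiedLine` — **`E'(K)[p] = 0` for every imaginary
  quadratic `K` in which `p` splits** (KY's standing "`H⁰(K, ρ̄_f) = 0`"): a `K`-point of order `p` is
  a non-zero `Γ_K`-fixed vector of `E'[p]` (`X11b.Transvection.exists_fixed_geomTorsion_of_point`);
  Clifford for the index-two subgroup `Γ_K ◁ Γ_ℚ` (`exists_rationalLine_fixed_of_fixed_of_index_two`,
  on `E[p]` directly: with `a ∉ Γ_K`, either `Q + aQ ≠ 0` is `Γ_ℚ`-fixed or `⟨Q⟩` is stable) yields a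
  rational line fixed pointwise by `Γ_K`, which contains every inertia group above the split — hence
  unramified — prime `p` (`inertia_le_range_absGaloisRestrict_of_split`, Neukirch I (9.6) via the
  tree's `inertia_le_range_absGaloisRestrict`): an unramified rational line, excluded by `hGL`.
  Corollaries `not_dvd_torsionOrder_baseChange_of_noUnramifiedLine` (`p ∤ #E'(K)_tors`, Cauchy) and
  `not_dvd_torsionOrder_of_noUnramifiedLine` (`p ∤ #E'(ℚ)_tors`, via x1a's
  `exists_isRationalLine_of_nsmul_eq_zero`).
* §2 `display55_at_goodLattice` — **[CGLS] display (5.5) for the good lattice at an anomalous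
  prime**, `ord_p #Ш(E'/K) = 2·(ord_p [E'(K):ℤP_K] − ord_p c_{E'}) − ord_p ∏_w c_w(E'/K)`, at one
  anticyclotomic datum `(ι, v, v̄, κ, γ)` and one Heegner datum `(Dt, H, ιC, P = P_K)`: the OPEN fact
  (a generator `𝓕` of `char_Λ 𝔛_{E'}` has `ord_p 𝓕(0) = 2(ord_p(1−a_p+p) − 1 + ord_p log P_K) −
  2 ord_p c_{E'}`) and the control theorem (a generator with `ord_p 𝓕(0) = ord_p #Ш(E'/K)[p^∞] +
  2((ord_p(1−a_p+p) − 1 + ord_p log P_K) − ord_p[E'(K):ℤP_K]) + ord_p ∏_w c_w`) describe the same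
  number; the ANOMALY FACTOR `ord_p(1 − a_p + p) − 1 ≥ 0` and the logarithm cancel — verbatim the
  non-anomalous kernel assembly `display55_at_of_display54_of_thm511` (lit-cgls session 6) with the two
  anomalous inputs swapped in and `E'(K)[p] = 0` DISCHARGED by §1.

File 2 (`X1/KellerYinTheoremA.lean`) continues: (5.5) + Gross–Zagier ⇒ (5.7) ⇒ the Keller–Yin display
⇒ `BSD(E',p)` (Greenberg–Vatsal on the type-B partner) ⇒ `BSD(E,p)` for every member (Cassels).

References: [KellerYin2024] arXiv:2402.12781v2 §0.2, Prop. 1.3.1, §1.4, Thm. 3.0.8, §4.2;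
[CastellaGrossiLeeSkinner2022] Thm. 5.1.1 + proof, Thm. 5.1.3, proof of Thm. 5.3.1 (5.4)–(5.5);
[JetchevSkinnerWan2017] Thm. 3.3.1, (3.5.d); [Serre1972] §2.3 p. 280; [NeukirchANT1999] I (9.6);
HOME/bsd-eis-ky-MEMO-1.md §2 (L2, L7–L12), §4; HOME/TARGET.md §1.1 ROUTING v1.5 (1).
-/

set_option autoImplicit false

noncomputable section

open scoped Classical

open WeierstrassCurve NumberField IsDedekindDomain Field Literature.NumberTheory.EllipticCurves
  Literature.NumberTheory.EllipticCurves.ModularForms Literature.NumberTheory.QuadraticFields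
  Literature.NumberTheory.EllipticCurves.Rank1Residual
  Literature.NumberTheory.EllipticCurves.CastellaGrossiLeeSkinner2022
  Literature.NumberTheory.EllipticCurves.Castella2018
  Literature.NumberTheory.EllipticCurves.KrizLi2019
  Literature.NumberTheory.GaloisRepresentations

open Literature.NumberTheory.EllipticCurves.KellerYin2024

namespace Summit.BirchSwinnertonDyer.Rank1Residual.X1.KellerYinGoodLattice

/-! ## §1 The good lattice has no `K`-rational `p`-torsion (memo L2; Clifford on `Γ_K ≤ Γ_ℚ`) -/

section NoTorsion

variable {K : Type} [Field K] [NumberField K] {p : ℕ} [Fact p.Prime]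

/-- **Inertia at a split prime lies in `Γ_K`.** For an imaginary quadratic `K` in which `p` splits,
a place `v ∋ p` of `ℚ` and a prime `𝔓` of `\bar ℤ` above `v`: `I_𝔓 ≤ res(Γ_K) ≤ Γ_ℚ` (`p` is
unramified in the Galois extension `K/ℚ`, `e(p) = 1` since `p` splits; Neukirch I (9.6), tree
`Automorphic.inertia_le_range_absGaloisRestrict`). [cite: NeukirchANT1999, Ch. I §9 (9.6)] -/
theorem inertia_le_range_absGaloisRestrict_of_split (hK : IsImaginaryQuadratic K)
    (hHp : SatisfiesHeegnerHypothesis p K) {v : HeightOneSpectrum (𝓞 ℚ)}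
    (hv : ((p : ℕ) : 𝓞 ℚ) ∈ v.asIdeal) {𝔓 : Ideal (absIntegers (𝓞 ℚ) ℚ)}
    (h𝔓 : 𝔓 ∈ v.primesAbove) :
    𝔓.inertia (absoluteGaloisGroup ℚ) ≤ (absGaloisRestrict ℚ K).range := by
  have hpP : p.Prime := Fact.out
  haveI : Algebra.IsQuadraticExtension ℚ K := ⟨hK.1⟩
  -- `v` is the place at `p`
  have hvp : v = X11b.ratPlace p := (natCast_mem_asIdeal_iff_eq_primesEquiv_symm v hpP).mp hv
  -- a prime `𝔭` of `K` above `p`, of ramification index `1`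
  have hsplit : X11b.SplitsIn K p := hHp p hpP (dvd_refl p)
  obtain ⟨𝔭, h𝔭, he, -⟩ := X11b.exists_degreeOnePrime_of_splitsIn (K := K) (p := p) hK.1 hsplit
  haveI : 𝔭.asIdeal.LiesOver v.asIdeal := by
    constructor
    rw [hvp, ← X11b.under_eq_ratPlace_of_mem h𝔭, HeightOneSpectrum.under_asIdeal]
  haveI : Module.Finite (𝓞 ℚ) (𝓞 K) := IsIntegralClosure.finite (𝓞 ℚ) ℚ K (𝓞 K)
  haveI : IsGaloisGroup (K ≃ₐ[ℚ] K) (𝓞 ℚ) (𝓞 K) :=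
    IsGaloisGroup.of_isFractionRing (K ≃ₐ[ℚ] K) (𝓞 ℚ) (𝓞 K) ℚ K
  have hIn : v.asIdeal.ramificationIdxIn (𝓞 K) = 1 := by
    rw [Ideal.ramificationIdxIn_eq_ramificationIdx v.asIdeal 𝔭.asIdeal (K ≃ₐ[ℚ] K)]
    exact he
  exact Literature.NumberTheory.GaloisRepresentations.inertia_le_range_absGaloisRestrict ℚ K hIn h𝔓

/-- **Clifford for an index-two subgroup of `Γ_ℚ`, on `E[p]` directly.** If a non-zero
`Q ∈ E(ℚ̄)[p]` is fixed by a subgroup `N ≤ Γ_ℚ` of index `2`, then some rational `p`-line `Φ ≤ E[p]`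
(order `p`, `Γ_ℚ`-stable) is fixed POINTWISE by `N`: with `a ∉ N` and `w = a • Q` (again `N`-fixed,
`N` being normal), either `Q + w ≠ 0` is fixed by all of `Γ_ℚ = N ∪ Na` and spans `Φ`, or `w = −Q`
and `Φ = ⟨Q⟩` is stable (`a` acts by `−1`). [cite: Serre1972, §2.3 p. 280 (Borel subgroups: stable lines)] -/
theorem exists_rationalLine_fixed_of_fixed_of_index_two {W : WeierstrassCurve ℚ}
    {N : Subgroup (absoluteGaloisGroup ℚ)} (hN : N.index = 2) {Q : geomTorsion W (p : ℤ)}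
    (hQ0 : Q ≠ 0) (hQ : ∀ σ ∈ N, σ • Q = Q) :
    ∃ Φ : AddSubgroup (geomTorsion W (p : ℤ)), IsRationalLine W p Φ ∧ ∀ σ ∈ N, ∀ P ∈ Φ, σ • P = P := by
  -- an element `a ∉ N`; `a² ∈ N`, conjugation by `a` preserves `N`, `g a⁻¹ ∈ N` for `g ∉ N`
  obtain ⟨a, haN, -⟩ := (Subgroup.index_eq_two_iff_exists_notMem_and).mp hN
  have hmul := fun {x y : absoluteGaloisGroup ℚ} ↦ Subgroup.mul_mem_iff_of_index_two hN (a := x) (b := y)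
  have ha2 : a * a ∈ N := hmul.mpr (by simp)
  have hainv : a⁻¹ ∉ N := fun h ↦ haN (by simpa using N.inv_mem h)
  have hconj : ∀ g ∈ N, a⁻¹ * g * a ∈ N := fun g hg ↦ by
    refine hmul.mpr ⟨fun h ↦ absurd h ?_, fun h ↦ absurd h haN⟩
    exact fun h' ↦ hainv ((hmul.mp h').mpr hg)
  have hsplit : ∀ g : absoluteGaloisGroup ℚ, g ∉ N → g * a⁻¹ ∈ N := fun g hg ↦
    hmul.mpr ⟨fun h ↦ absurd h hg, fun h ↦ absurd h hainv⟩
  -- `w = a • Q` is `N`-fixed and `a • w = Q`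
  set w : geomTorsion W (p : ℤ) := a • Q with hw
  have hwN : ∀ g ∈ N, g • w = w := fun g hg ↦ by
    have h1 : g = a * (a⁻¹ * g * a) * a⁻¹ := by group
    rw [hw, ← mul_smul, h1, mul_assoc, mul_assoc, inv_mul_cancel, mul_one, mul_smul, hQ _ (hconj g hg)]
  have haw : a • w = Q := by rw [hw, ← mul_smul, hQ _ ha2]
  have hgQ : ∀ g : absoluteGaloisGroup ℚ, g ∉ N → g • Q = w := fun g hg ↦ by
    have h1 : g = (g * a⁻¹) * a := by group
    rw [h1, mul_smul, ← hw, hwN _ (hsplit g hg)]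
  have hgw : ∀ g : absoluteGaloisGroup ℚ, g ∉ N → g • w = Q := fun g hg ↦ by
    have h1 : g = (g * a⁻¹) * a := by group
    rw [h1, mul_smul, haw, hQ _ (hsplit g hg)]
  -- the generator `x` of the line: `Q + w` if non-zero, else `Q`; `N` fixes it, `Γ_ℚ` acts by `±1`
  obtain ⟨x, hx0, hxN, hxG⟩ : ∃ x : geomTorsion W (p : ℤ), x ≠ 0 ∧ (∀ σ ∈ N, σ • x = x) ∧
      ∀ σ : absoluteGaloisGroup ℚ, σ • x = x ∨ σ • x = -x := by
    by_cases hsum : Q + w = 0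
    · have hwQ : w = -Q := eq_neg_of_add_eq_zero_right hsum
      refine ⟨Q, hQ0, hQ, fun σ ↦ ?_⟩
      by_cases hσ : σ ∈ N
      · exact Or.inl (hQ σ hσ)
      · exact Or.inr (by rw [hgQ σ hσ, hwQ])
    · refine ⟨Q + w, hsum, fun σ hσ ↦ by rw [smul_add, hQ σ hσ, hwN σ hσ], fun σ ↦ Or.inl ?_⟩
      by_cases hσ : σ ∈ N
      · rw [smul_add, hQ σ hσ, hwN σ hσ]
      · rw [smul_add, hgQ σ hσ, hgw σ hσ, add_comm]
  -- the line `Φ = ℤ x` has order `p`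
  have hpx : p • x = 0 := by
    have h2 : ((p : ℕ) : ℤ) • (x : geomPoints W) = 0 := (Submodule.mem_torsionBy_iff _ _).mp x.2
    apply Subtype.ext
    rw [AddSubmonoidClass.coe_nsmul, ZeroMemClass.coe_zero, ← natCast_zsmul]
    exact h2
  have hord : addOrderOf x = p := addOrderOf_eq_prime hpx hx0
  refine ⟨AddSubgroup.zmultiples x, ⟨?_, ?_⟩, ?_⟩
  · rw [Nat.card_zmultiples, hord]
  · -- `Γ_ℚ`-stable: `σ • (n • x) = n • (σ • x) = ± n • x`
    intro σ P hP
    obtain ⟨n, rfl⟩ := AddSubgroup.mem_zmultiples_iff.mp hP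
    rw [smul_comm σ n x]
    rcases hxG σ with h | h
    · rw [h]; exact AddSubgroup.zsmul_mem_zmultiples x n
    · rw [h, zsmul_neg, ← neg_zsmul]; exact AddSubgroup.zsmul_mem_zmultiples x (-n)
  · -- `N` fixes `Φ` pointwise
    intro σ hσ P hP
    obtain ⟨n, rfl⟩ := AddSubgroup.mem_zmultiples_iff.mp hP
    rw [smul_comm σ n x, hxN σ hσ]

/-- **The good lattice has no `K`-rational `p`-torsion** (memo L2, = Keller–Yin's standing
`H⁰(K, ρ̄_f) = 0` for their lattice, Prop. 1.3.1 / §1.4): if NO rational `p`-line of `E` is unramified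
at `p` (KY's normalisation: `E[p]` non-split with `p`-ramified sub-line), then for every imaginary
quadratic `K` in which `p` SPLITS, `E(K)[p] = 0`. Proof: a `K`-point of order `p` gives a non-zero
`Γ_K`-fixed vector of `E[p]` (`exists_fixed_geomTorsion_of_point`), hence (Clifford,
`exists_rationalLine_fixed_of_fixed_of_index_two`, `[Γ_ℚ : Γ_K] = 2`) a rational line fixed pointwise
by `Γ_K ⊇ I_𝔓` for every `𝔓 ∣ p` (`inertia_le_range_absGaloisRestrict_of_split`) — an UNRAMIFIED
rational line, excluded. [cite: KellerYin2024, §0.2 and §1.4 (arXiv:2402.12781v2 L262–L266, L1077–L1086: "no nonzero trivial subrepresentation over G_K")]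
[cite: Serre1972, §2.3 p. 280] -/
theorem torsion_baseChange_eq_zero_of_noUnramifiedLine {W : WeierstrassCurve ℚ}
    (hGL : ∀ Φ : AddSubgroup (geomTorsion W (p : ℤ)), IsRationalLine W p Φ → ¬ LineUnramifiedAt W p Φ)
    (hK : IsImaginaryQuadratic K) (hHp : SatisfiesHeegnerHypothesis p K) :
    ∀ Q : (W.baseChange K).toAffine.Point, p • Q = 0 → Q = 0 := by
  intro Q hQ
  by_contra hQ0
  have hQz : (p : ℤ) • Q = 0 := by rw [natCast_zsmul]; exact hQ
  obtain ⟨T, hT0, hfix⟩ := X11b.Transvection.exists_fixed_geomTorsion_of_point W K Q hQz hQ0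
  have hindex : ((absGaloisRestrict ℚ K).range : Subgroup (absoluteGaloisGroup ℚ)).index = 2 :=
    (Literature.NumberTheory.Automorphic.isOpen_range_absGaloisRestrict_and_index_eq_two ℚ K hK.1).2
  obtain ⟨Φ, hΦ, hΦfix⟩ :=
    exists_rationalLine_fixed_of_fixed_of_index_two hindex hT0 (fun σ hσ ↦ hfix σ hσ)
  refine hGL Φ hΦ ?_
  intro v hv 𝔓 h𝔓 σ hσ P hP
  exact hΦfix σ (inertia_le_range_absGaloisRestrict_of_split hK hHp hv h𝔓 hσ) P hP

/-- **Hence `p ∤ #E(K)_tors`** for the good lattice at a split `p` (Cauchy in the finite group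
`E(K)_tors`, Silverman AEC VIII.7). [folklore] -/
theorem not_dvd_torsionOrder_baseChange_of_noUnramifiedLine {W : WeierstrassCurve ℚ} [W.IsElliptic]
    (hGL : ∀ Φ : AddSubgroup (geomTorsion W (p : ℤ)), IsRationalLine W p Φ → ¬ LineUnramifiedAt W p Φ)
    (hK : IsImaginaryQuadratic K) (hHp : SatisfiesHeegnerHypothesis p K) :
    ¬ p ∣ (W.baseChange K).torsionOrder := by
  intro hdvd
  haveI : (W.baseChange K).IsElliptic := isElliptic_baseChange' W K
  haveI := (W.baseChange K).finite_torsion_point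
  unfold WeierstrassCurve.torsionOrder at hdvd
  obtain ⟨t, ht⟩ := exists_prime_addOrderOf_dvd_card' p hdvd
  have ht' : addOrderOf (t : (W.baseChange K).toAffine.Point) = p := by
    rw [AddSubgroup.addOrderOf_coe, ht]
  have hpt : p • (t : (W.baseChange K).toAffine.Point) = 0 := by
    rw [← ht']; exact addOrderOf_nsmul_eq_zero _
  have ht0 : (t : (W.baseChange K).toAffine.Point) ≠ 0 := by
    intro h0
    have h1 : addOrderOf (t : (W.baseChange K).toAffine.Point) = 1 := by rw [h0, addOrderOf_zero]
    rw [ht'] at h1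
    exact (Fact.out : p.Prime).one_lt.ne' h1
  exact ht0 (torsion_baseChange_eq_zero_of_noUnramifiedLine hGL hK hHp _ hpt)

/-- **The good lattice has no RATIONAL `p`-torsion either**: a rational point of order `p` spans a
rational line on which `Γ_ℚ` acts trivially — unramified at `p` (`exists_isRationalLine_of_nsmul_eq_zero`,
x1a) —, excluded by the normalisation. [cite: KellerYin2024, §0.2 (arXiv:2402.12781v2 L262–L266)] -/
theorem not_dvd_torsionOrder_of_noUnramifiedLine {W : WeierstrassCurve ℚ} [W.IsElliptic]
    (hGL : ∀ Φ : AddSubgroup (geomTorsion W (p : ℤ)), IsRationalLine W p Φ → ¬ LineUnramifiedAt W p Φ) :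
    ¬ p ∣ W.torsionOrder := by
  intro hdvd
  obtain ⟨T, hT⟩ := exists_addOrderOf_eq_of_dvd_torsionOrder W p hdvd
  have hpT : p • T = 0 := by rw [← hT]; exact addOrderOf_nsmul_eq_zero T
  have hT0 : T ≠ 0 := by
    intro h0
    rw [h0, addOrderOf_zero] at hT
    exact (Fact.out : p.Prime).one_lt.ne hT
  obtain ⟨Φ, hΦ, -, hunr, -⟩ := exists_isRationalLine_of_nsmul_eq_zero W T hT0 hpT
  exact hGL Φ hΦ hunr


end NoTorsion

/-! ## §2 Display (5.5) for the good lattice at an anomalous prime: KY IMC2 at `𝟙` ∘ BDP + control -/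

section Datum

variable {W : WeierstrassCurve ℚ} [W.IsElliptic] [W.IsGloballyMinimal] {p : ℕ} [Fact p.Prime]
  {K : Type} [Field K] [NumberField K]

/-- **Display (5.5) of [CGLS] at one datum FOR THE GOOD LATTICE AT AN ANOMALOUS PRIME** — memo
THEOREM A, links L7–L12 at the level of `K`: `ord_p #Ш(E'/K) = 2·ord_p(c_{E'}⁻¹ [E'(K):ℤP_K]) −
Σ_w ord_p c_w(E'/K)`. Inputs: the OPEN fact `h308` (Keller–Yin Thm. 3.0.8 (IMC2) at `𝟙` ∘ [CGLS]
Thm. 5.1.3 for the good lattice: a generator `𝓕` of `char_Λ(𝔛_{E'})` has `ord_p 𝓕(0) = 2(ord_p(1−a_p+p)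
− 1 + ord_p log P_K) − 2 ord_p c_{E'}` once `𝓕(0) ≠ 0`) and the PUBLISHED-AS-PROVED control theorem
`h511` ([CGLS] Thm. 5.1.1 under `E'(K)[p] = 0`: a generator with `𝓕(0) ≠ 0` and `ord_p 𝓕(0) =
ord_p #Ш(E'/K)[p^∞] + 2((ord_p(1−a_p+p) − 1 + ord_p log P_K) − ord_p[E'(K):ℤP_K]) + ord_p ∏_w c_w`);
the two agree (one generator), the anomaly factor `ord_p(1 − a_p + p) − 1 ≥ 0` and the logarithm
CANCEL exactly as in the non-anomalous kernel assembly `display55_at_of_display54_of_thm511`, and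
`ord_p #Ш[p^∞] = ord_p #Ш` for the finite `Ш(E'/K)`. The hypothesis `E'(K)[p] = 0` of both facts is
DISCHARGED by §1 (`torsion_baseChange_eq_zero_of_noUnramifiedLine`: no unramified rational line + `p`
split in `K`); (Sel) by the corank theorem from `rank E'(K) = 1` and `Ш(E'/K)` finite.
[claim: KellerYin2024, status: under-review]
[cite: KellerYin2024, Thm. 3.0.8 (IMC2) and proof of Thm. 4.2.1 (arXiv:2402.12781v2 §4.2)]
[cite: CastellaGrossiLeeSkinner2022, proof of Thm. 5.3.1, (5.4)–(5.5) (arXiv v2 TeX L2616–L2634), Thm. 5.1.1 and its proof, Thm. 5.1.3] -/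
theorem display55_at_goodLattice (h308 : thm308_imc2_bdpValue_goodLattice_OPEN)
    (h511 : thm511_anticyclotomicControl_of_torsionFree) (hp : 2 < p) (hgood : Good W p)
    (hred : Red W p) (han : Anom W p)
    (hGL : ∀ Φ : AddSubgroup (geomTorsion W (p : ℤ)), IsRationalLine W p Φ → ¬ LineUnramifiedAt W p Φ)
    (hK : IsImaginaryQuadratic K) (hodd : Odd (NumberField.discr K))
    (h3 : NumberField.discr K ≠ -3) (hHN : SatisfiesHeegnerHypothesis (W.conductorNorm ℤ) K)
    (hHp : SatisfiesHeegnerHypothesis p K) (ι : K →+* ℚ_[p]) (v vbar : HeightOneSpectrum (𝓞 K))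
    (hv : ∀ x : 𝓞 K, x ∈ v.asIdeal ↔ ‖ι (x : K)‖ < 1)
    (hvbar : ((p : ℕ) : 𝓞 K) ∈ vbar.asIdeal) (hne : vbar ≠ v)
    (κ : ZpExtension K p) (hκ : κ.IsAnticyclotomic)
    (γ : Field.absoluteGaloisGroup K) [Fact (κ.IsTopGenerator γ)]
    {N : ℕ} [NeZero N] (Dt : ModularParametrizationData W N)
    (H : HeegnerDatum N (NumberField.discr K)) (ιC : K →+* ℂ) (P : (W.baseChange K).toAffine.Point)
    (hP : WeierstrassCurve.Affine.Point.map ιC.toRatAlgHom P = heegnerPointComplex Dt H)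
    (hrk : (W.baseChange K).mordellWeilRank = 1) (hfin : Finite (W.baseChange K).sha)
    (hPinf : ¬ IsOfFinAddOrder P) :
    (padicValNat p (W.baseChange K).shaOrder : ℤ) =
      2 * ((padicValNat p (AddSubgroup.zmultiples P).index : ℤ) - (padicValInt p Dt.c : ℤ)) -
        (padicValNat p (W.baseChange K).tamagawaProduct : ℤ) := by
  -- adapted from `display55_at_of_display54_of_thm511` (lit-cgls session 6), anomalous inputs swapped in
  haveI hfinp : Finite (AddCommGroup.primaryComponent (W.baseChange K).sha p) := inferInstance
  -- (Sel) from rank 1 and finite `Ш[p^∞]`, by the corank theorem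
  have hshaK : (W.baseChange K).shaCorank p = 0 :=
    (finite_primaryComponent_sha_iff_shaCorank_eq_zero (W.baseChange K) p).mp hfinp
  have hSel : (W.baseChange K).selmerCorank p = 1 := by
    rw [(W.baseChange K).selmerCorank_eq_mordellWeilRank_add_holds p, hrk, hshaK]
  -- `E'(K)[p] = 0` for the good lattice at the split prime `p` (§1)
  have hEK : ∀ Q : (W.baseChange K).toAffine.Point, p • Q = 0 → Q = 0 :=
    torsion_baseChange_eq_zero_of_noUnramifiedLine hGL hK hHp
  -- Thm. 5.1.1 (as proved) at `P = P_K`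
  obtain ⟨-, F, hF, hF0, h511v⟩ := h511 W p hp (goodOrd_of_red_of_good W p hp hgood hred) K hK hHp hHN
    ι v vbar hv hvbar hne κ hκ γ hEK hrk hfinp P hPinf
  -- KY IMC2 at `𝟙` ∘ Thm. 5.1.3 for the same generator
  have h308v := valuation_generator_constantCoeff_of_thm308 h308 hp hgood hred han hGL K hK hHN hHp hodd
    h3 hEK hSel ι v vbar hv hvbar hne κ hκ γ Dt H ιC P hP F hF hF0
  -- `ord_p #Ш[p^∞] = ord_p #Ш`
  have hsha : padicValNat p (Nat.card (AddCommGroup.primaryComponent (W.baseChange K).sha p)) =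
      padicValNat p (W.baseChange K).shaOrder := by
    rw [natCard_primaryComponent_eq_pow_padicValNat p, padicValNat.prime_pow]
    rfl
  rw [h308v, hsha] at h511v
  omega

end Datum

end Summit.BirchSwinnertonDyer.Rank1Residual.X1.KellerYinGoodLattice

end
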